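import Summits.BirchSwinnertonDyer.BirchSwinnertonDyer.Theorems.QuadraticBranchSignedControlPlusEtaNonsurjCMAnchorTransfer
import Summits.BirchSwinnertonDyer.BirchSwinnertonDyer.Theorems.QuadraticBranchSignedControlPlusEtaNonsurjCorpuzLeiTransferOPEN
import Summits.BirchSwinnertonDyer.BirchSwinnertonDyer.Theorems.QuadraticBranchSignedControlPlusEtaNonsurjModFiveCongruenceRecordsB
import Summits.BirchSwinnertonDyer.BirchSwinnertonDyer.Theorems.QuadraticBranchSignedControlPlusEtaNonsurjModFiveCongruenceRecordsC
import Summits.BirchSwinnertonDyer.BirchSwinnertonDyer.Theorems.QuadraticBranchSignedControlPlusEtaNonsurjModFiveCongruenceRecordsD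
import Summits.BirchSwinnertonDyer.BirchSwinnertonDyer.Theorems.QuadraticBranchSignedControlPlusEtaNonsurjFineRoadRecordsC
import Summits.BirchSwinnertonDyer.BirchSwinnertonDyer.Theorems.QuadraticBranchSignedControlPlusEtaNonsurjFineRoadRecordsD
import Summits.BirchSwinnertonDyer.BirchSwinnertonDyer.Theorems.QuadraticBranchSignedControlPlusEtaNonsurjFineRoadRecordsE
import Summits.BirchSwinnertonDyer.BirchSwinnertonDyer.Theorems.QuadraticBranchSignedControlPlusEtaNonsurjPrimeLFunctionRecordsA
import Summits.BirchSwinnertonDyer.BirchSwinnertonDyer.Theorems.QuadraticBranchSignedControlPlusEtaNonsurjPrimeLFunctionRecordsB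
import HarnessLib

/-!
# Route `QuadraticBranchSignedControl` (rung K8, cell `bsd-potss`), residual crux `PlusEtaMainConjectureNonsurj`
# (stmt-BirchSwinnertonDyer-19606): the CM-UNIT-ANCHOR TRANSFER RECORDS — (C1⁺_η) at `p = 5` per row for the NON-CM rows of
# the crux below `5·10⁵`, part A: kernel facts (§0) + the first 5 rank-0 rows (a `--supports` file; seat `bsd-potss-k8eta-c2` g8; nothing booked, BSD is not proved by any of this)

WHAT. Crux 19606 has 30 non-CM rows below `5·10⁵` (all `p = 5`, image `C_ns⁺(5)`; 12 of rank 0, 16 of rank 1, 2 of rank 2;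
HOME/k8eta-c2/g3/nononto_rows.tsv). EVERY one of them is `5`-congruent to a CM UNIT ANCHOR `A` (CM, `r_an = 0`, `#Ш_an = 1`,
`5 ∤ Tam(A)`: `900b1`, `3600bb1`, `10800cj1`, `11025e1`, `14400cz1`, or the unit siblings `[0,0,0,0,−675]`, `[0,0,1,0,−169]`,
`[0,0,0,0,800]`, `[0,0,1,0,−405169]`), by an explicit point of one of Fisher's Hesse families — this seat's census
`pub/bsd-potss/k8eta-c2/g8/K8-CM-UNIT-ANCHORS-k8eta-c2-g8.tsv` (30/30) and kernel records `EtaModFiveCongruenceRecords.modPCongruent_twist5_*`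
(parts B/C/D; conditional on Fisher's published Thm. 13.2 / Thm. 5.8 only). THIS FILE instantiates the CM-unit-anchor transfer
road `EtaCMAnchorTransfer.quadraticBranchPlusEtaMainConjectureAt_of_cmUnitAnchor_of_transferFrame` per row: Kobayashi's even
main conjecture at `η` for every good `a_5 = 0` globally minimal model `V` of the row's `5`-twist, GIVEN a good `a_5 = 0` globally
minimal model `V′` of the anchor's `5`-twist, MODULO the OPEN binder `hCL` (`CorpuzLei2025_etaPlusMainConjecture_transfer_OPEN`; Corpuz–Lei arXiv:2508.09733 Thms 1–3 at
`i = (p−1)/2` — PREPRINT, `[claim: …, status: under-review]`), the named facts modularity / GZK / Burungale–Flach bsd.S28 /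
one Fisher fact, and per row ONLY the anchor's displayed `L(A,1) ≠ 0`, `#Ш(A)_an = 1`, `5 ∤ Tam(A)`. In particular the four rows
where the Eisenstein stub `stub_etaMC_nonCM_lower` kept open content in-table after g7 — `242325g1`, `404325g1` (rank 1, non-prime
`L_5⁺`) and `162675m1`, `242325h1` (rank 2) — are settled in shape here exactly like the others.

HONEST FRAMING (cell `bsd-potss`; HUMAN RULING D-0036/D-0074): BOOKKEEPING THEOREMS ONLY — no definition, no new fact, no `sorry`,
axioms standard; CONDITIONAL on `hCL` (an unrefereed preprint read through the flagged dictionary `CL25-eta-plus-dictionary`) and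
on the named facts in hypothesis position. 19606 stays OPEN (CM rows; class-wide the non-CM rows without a CM unit anchor; the
binder is PRE); no stub is proved by name; nothing is booked; BSD(W,5) is claimed for no pair; no label / mark / count moves.
`--supports stmt-BirchSwinnertonDyer-19606`.

References: [CorpuzLei2025] Thms 1–3 (claim; hypothesis only); [GreenbergVatsal2000] Thm. (1.4); [Kobayashi2003] §4 (p. 8);
[BurungaleFlach2024] Thm. 1.1, Cor. 2; [Fisher2012Hessian] Thm. 13.2; [Fisher2013TwistsOfX5] Thm. 5.8; [Cremona1997] Table 1.
-/

set_option autoImplicit false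
set_option linter.dupNamespace false

noncomputable section

open scoped Classical

open CongruenceSubgroup Field Function NumberField IsDedekindDomain WeierstrassCurve
open Literature.NumberTheory.EllipticCurves
open Literature.NumberTheory.EllipticCurves.ModularForms
open Literature.NumberTheory.EllipticCurves.Rank1Residual
open Literature.NumberTheory.EllipticCurves.Rank1Residual.Typed
open Literature.NumberTheory.GaloisRepresentations
open Literature.NumberTheory.GaloisCohomology
open Literature.NumberTheory.EllipticCurves.IwasawaAlgebra
open Literature.NumberTheory.EllipticCurves.IwasawaDual ZpExtension
open Literature.NumberTheory.EllipticCurves.GreenbergVatsal2000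
open Literature.NumberTheory.EllipticCurves.HesseFamilyFive (thm132_geomTorsionFive_of_hesseFamily
  thm58_geomTorsionFive_of_dualHesseFamily)
open Summit.BirchSwinnertonDyer.Rank1Residual.X11b.Levels
open Summit.BirchSwinnertonDyer.Rank1Residual.X11b
open Summit.BirchSwinnertonDyer.Rank1Residual.Additive
open Summit.BirchSwinnertonDyer.Rank1Residual.Additive.SignedTwist
open scoped ContRepresentation
open Summit.BirchSwinnertonDyer.Rank1Residual.AdditivePotMult
open Summit.BirchSwinnertonDyer.Rank1Residual.O6 (ModPCongruent)

namespace Summit.BirchSwinnertonDyer.BirchSwinnertonDyer.Theorems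

namespace EtaCMAnchorTransferRecords

/-! ## §0 Kernel facts -/

/-- `104400cr1` = `[0, 0, 0, -77625, 17404875]` (non-CM, `N = 104400`, rank `0`; Cremona: `Tam = 4`, `#Ш_an = 1`): `Δ ≠ 0` (kernel).
[cite: Cremona1997, Table 1 (label 104400cr1)] -/
theorem isElliptic_104400cr1 : (⟨0, 0, 0, (-77625), 17404875⟩ : WeierstrassCurve ℚ).IsElliptic :=
  isElliptic_of_discOf_ne_zero 0 0 0 (-77625) 17404875 (by decide +kernel)

/-- `26100c1` = `[0, 0, 0, -77625, -17404875]` (non-CM, `N = 26100`, rank `0`; Cremona: `Tam = 4`, `#Ш_an = 4`): `Δ ≠ 0` (kernel).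
[cite: Cremona1997, Table 1 (label 26100c1)] -/
theorem isElliptic_26100c1 : (⟨0, 0, 0, (-77625), (-17404875)⟩ : WeierstrassCurve ℚ).IsElliptic :=
  isElliptic_of_discOf_ne_zero 0 0 0 (-77625) (-17404875) (by decide +kernel)

/-- `313200ek1` = `[0, 0, 0, -78375, 5017250]` (non-CM, `N = 313200`, rank `0`; Cremona: `Tam = 6`, `#Ш_an = 1`): `Δ ≠ 0` (kernel).
[cite: Cremona1997, Table 1 (label 313200ek1)] -/
theorem isElliptic_313200ek1 : (⟨0, 0, 0, (-78375), 5017250⟩ : WeierstrassCurve ℚ).IsElliptic :=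
  isElliptic_of_discOf_ne_zero 0 0 0 (-78375) 5017250 (by decide +kernel)

/-- `417600je1` = `[0, 0, 0, -34500, -5157000]` (non-CM, `N = 417600`, rank `0`; Cremona: `Tam = 4`, `#Ш_an = 1`): `Δ ≠ 0` (kernel).
[cite: Cremona1997, Table 1 (label 417600je1)] -/
theorem isElliptic_417600je1 : (⟨0, 0, 0, (-34500), (-5157000)⟩ : WeierstrassCurve ℚ).IsElliptic :=
  isElliptic_of_discOf_ne_zero 0 0 0 (-34500) (-5157000) (by decide +kernel)

/-- `458100m1` = `[0, 0, 0, -23670375, -44229269250]` (non-CM, `N = 458100`, rank `0`; Cremona: `Tam = 12`, `#Ш_an = 4`): `Δ ≠ 0` (kernel).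
[cite: Cremona1997, Table 1 (label 458100m1)] -/
theorem isElliptic_458100m1 : (⟨0, 0, 0, (-23670375), (-44229269250)⟩ : WeierstrassCurve ℚ).IsElliptic :=
  isElliptic_of_discOf_ne_zero 0 0 0 (-23670375) (-44229269250) (by decide +kernel)

/-- `242325g1` = `[0, 0, 1, -379500, -47684344]` (non-CM, `N = 242325`, rank `1`; Cremona: `Tam = 2`, `#Ш_an = 1`): `Δ ≠ 0` (kernel).
[cite: Cremona1997, Table 1 (label 242325g1)] -/
theorem isElliptic_242325g1 : (⟨0, 0, 1, (-379500), (-47684344)⟩ : WeierstrassCurve ℚ).IsElliptic :=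
  isElliptic_of_discOf_ne_zero 0 0 1 (-379500) (-47684344) (by decide +kernel)

/-- `404325g1` = `[0, 0, 1, -30778500, -65718132719]` (non-CM, `N = 404325`, rank `1`; Cremona: `Tam = 6`, `#Ш_an = 1`): `Δ ≠ 0` (kernel).
[cite: Cremona1997, Table 1 (label 404325g1)] -/
theorem isElliptic_404325g1 : (⟨0, 0, 1, (-30778500), (-65718132719)⟩ : WeierstrassCurve ℚ).IsElliptic :=
  isElliptic_of_discOf_ne_zero 0 0 1 (-30778500) (-65718132719) (by decide +kernel)

/-- `162675m1` = `[0, 0, 1, -1152750, 483818656]` (non-CM, `N = 162675`, rank `2`; Cremona: `Tam = 30`, `#Ш_an = 1`): `Δ ≠ 0` (kernel).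
[cite: Cremona1997, Table 1 (label 162675m1)] -/
theorem isElliptic_162675m1 : (⟨0, 0, 1, (-1152750), 483818656⟩ : WeierstrassCurve ℚ).IsElliptic :=
  isElliptic_of_discOf_ne_zero 0 0 1 (-1152750) 483818656 (by decide +kernel)

/-- `242325h1` = `[0, 0, 1, -3415500, 1287477281]` (non-CM, `N = 242325`, rank `2`; Cremona: `Tam = 10`, `#Ш_an = 1`): `Δ ≠ 0` (kernel).
[cite: Cremona1997, Table 1 (label 242325h1)] -/
theorem isElliptic_242325h1 : (⟨0, 0, 1, (-3415500), 1287477281⟩ : WeierstrassCurve ℚ).IsElliptic :=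
  isElliptic_of_discOf_ne_zero 0 0 1 (-3415500) 1287477281 (by decide +kernel)

set_option maxRecDepth 100000 in
/-- The CM unit anchor `900b1` = `[0,0,0,0,125]` has CM: `j = c₄³/Δ = 0` is one of the thirteen CM `j`-invariants (kernel, through the tree theorem
`hasCM_iff_j_mem_holds`; pattern of `EtaFineRoadRecords.hasCM_A2700`). [cite: SilvermanAEC2009, Appendix C §11] -/
theorem hasCM_900b1 : (⟨0, 0, 0, 0, 125⟩ : WeierstrassCurve ℚ).HasCM := by
  have hj := @EtaUnitRows.ratCurve_j 0 0 0 0 125 EtaCMUnitRecords.isElliptic_900b1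
  push_cast at hj
  haveI := EtaCMUnitRecords.isElliptic_900b1
  exact (hasCM_iff_j_mem_holds _).mpr (by rw [hj]; decide +kernel)

set_option maxRecDepth 100000 in
/-- The CM unit anchor `3600bb1` = `[0,0,0,0,−125]` has CM: `j = c₄³/Δ = 0` is one of the thirteen CM `j`-invariants (kernel, through the tree theorem
`hasCM_iff_j_mem_holds`; pattern of `EtaFineRoadRecords.hasCM_A2700`). [cite: SilvermanAEC2009, Appendix C §11] -/
theorem hasCM_3600bb1 : (⟨0, 0, 0, 0, (-125)⟩ : WeierstrassCurve ℚ).HasCM := by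
  have hj := @EtaUnitRows.ratCurve_j 0 0 0 0 (-125) EtaCMUnitRecords.isElliptic_3600bb1
  push_cast at hj
  haveI := EtaCMUnitRecords.isElliptic_3600bb1
  exact (hasCM_iff_j_mem_holds _).mpr (by rw [hj]; decide +kernel)

set_option maxRecDepth 100000 in
/-- The CM unit anchor `10800cj1` = `[0,0,0,0,−500]` has CM: `j = c₄³/Δ = 0` is one of the thirteen CM `j`-invariants (kernel, through the tree theorem
`hasCM_iff_j_mem_holds`; pattern of `EtaFineRoadRecords.hasCM_A2700`). [cite: SilvermanAEC2009, Appendix C §11] -/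
theorem hasCM_10800cj1 : (⟨0, 0, 0, 0, (-500)⟩ : WeierstrassCurve ℚ).HasCM := by
  have hj := @EtaUnitRows.ratCurve_j 0 0 0 0 (-500) EtaCMUnitRecords.isElliptic_10800cj1
  push_cast at hj
  haveI := EtaCMUnitRecords.isElliptic_10800cj1
  exact (hasCM_iff_j_mem_holds _).mpr (by rw [hj]; decide +kernel)

set_option maxRecDepth 100000 in
/-- The CM unit anchor `11025e1` = `[0,0,1,0,−525219]` has CM: `j = c₄³/Δ = 0` is one of the thirteen CM `j`-invariants (kernel, through the tree theorem
`hasCM_iff_j_mem_holds`; pattern of `EtaFineRoadRecords.hasCM_A2700`). [cite: SilvermanAEC2009, Appendix C §11] -/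
theorem hasCM_11025e1 : (⟨0, 0, 1, 0, (-525219)⟩ : WeierstrassCurve ℚ).HasCM := by
  have hj := @EtaUnitRows.ratCurve_j 0 0 1 0 (-525219) EtaCMUnitRecords.isElliptic_11025e1
  push_cast at hj
  haveI := EtaCMUnitRecords.isElliptic_11025e1
  exact (hasCM_iff_j_mem_holds _).mpr (by rw [hj]; decide +kernel)

set_option maxRecDepth 100000 in
/-- The CM unit anchor `14400cz1` = `[0,0,0,0,−1000]` has CM: `j = c₄³/Δ = 0` is one of the thirteen CM `j`-invariants (kernel, through the tree theorem
`hasCM_iff_j_mem_holds`; pattern of `EtaFineRoadRecords.hasCM_A2700`). [cite: SilvermanAEC2009, Appendix C §11] -/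
theorem hasCM_14400cz1 : (⟨0, 0, 0, 0, (-1000)⟩ : WeierstrassCurve ℚ).HasCM := by
  have hj := @EtaUnitRows.ratCurve_j 0 0 0 0 (-1000) EtaCMUnitRecords.isElliptic_14400cz1
  push_cast at hj
  haveI := EtaCMUnitRecords.isElliptic_14400cz1
  exact (hasCM_iff_j_mem_holds _).mpr (by rw [hj]; decide +kernel)

/-! ## §1 Records -/

set_option maxRecDepth 100000 in
/-- **(C1⁺_η) at `p = 5` for every good `a_5 = 0` globally minimal model `V` of the `5`-twist of `26100c1`**
(`[0, 0, 0, -77625, -17404875]`; non-CM, `Im ρ̄ = C_ns⁺(5)`, rank `0`; Cremona: `Tam = 4`, `#Ш_an = 4`) BY THE CM-UNIT-ANCHOR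
TRANSFER ROAD: the row is `5`-congruent to `900b1` = `[0,0,0,0,125]` (CM, `r_an = 0`, `#Ш_an = 1`, `Tam = 4`; displayed
`hLA hm htam`) — on the twist side the congruence `V′[5] ≃ V[5]` for ALL models is the kernel record
`EtaModFiveCongruenceRecords.modPCongruent_twist5_900b1_26100c1` (the twisted row is the point `(λ:μ) = (-300 : 1)` of the
DIRECT Hesse family of the twisted anchor), conditional on Fisher's `thm132_geomTorsionFive_of_hesseFamily` only; at the
anchor's twist (C1⁺_η) and `μ = 0` are TREE THEOREMS (`EtaUnitRows`, `EtaMuBound`; mod `hmod hGZK hS28`); the transfer is the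
OPEN binder `hCL` (Corpuz–Lei 2025 Thms 1–3 at `i = (p−1)/2`, PREPRINT). NO hypothesis on the row beyond its model: no rank, no
`L`-value, no shape of `L_5⁺`, no analytic `μ`, no Kobayashi Thm. 2.2/4.1, no Hatley–Lei, no Poitou–Tate, no Kitajima–Otsuki, no
(A), no `L₀`. Per-row instance of `EtaCMAnchorTransfer.quadraticBranchPlusEtaMainConjectureAt_of_cmUnitAnchor_of_transferFrame`;
CONDITIONAL on `hCL` (PRE) and the named facts; nothing booked; BSD(W,5) claimed for no pair.
[claim: CorpuzLei2025, status: under-review] [cite: Fisher2012Hessian, Thm. 13.2 (i)]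
[cite: Kobayashi2003, §4 Even main conjecture (p. 8)] [cite: GreenbergVatsal2000, Thm. (1.4)]
[cite: BurungaleFlach2024, Thm. 1.1 and Cor. 2] [cite: Cremona1997, Table 1 (label 26100c1)] -/
theorem etaMC_26100c1_5_cmAnchorTransfer (hCL : CorpuzLei2025_etaPlusMainConjecture_transfer_OPEN)
    (hmod : hasEntireLFunction_rat) (hGZK : rank_eq_analyticRank_of_analyticRank_le_one)
    (hS28 : bsdTriple_of_hasCM_of_L_one_ne_zero) (hF : thm132_geomTorsionFive_of_hesseFamily)
    (W : WeierstrassCurve ℚ) (hW : W = ⟨0, 0, 0, (-77625), (-17404875)⟩) (A : WeierstrassCurve ℚ) (hA : A = ⟨0, 0, 0, 0, 125⟩)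
    (hLA : A.entireLFunction 1 ≠ 0) (hm : shaAn A = ((1 : ℕ) : ℂ)) (htam : ¬ 5 ∣ A.tamagawaProduct) :
    ∀ (V' : WeierstrassCurve ℚ) [V'.IsElliptic] [V'.IsGloballyMinimal]
      (V : WeierstrassCurve ℚ) [V.IsElliptic] [V.IsGloballyMinimal] [Fact (5 : ℕ).Prime],
      (∃ C' : VariableChange ℚ, C' • A.quadraticTwist (5) = V') →
      V'.HasGoodReductionAtPrime 5 → V'.frobeniusTrace 5 = 0 →
      (∃ C : VariableChange ℚ, C • W.quadraticTwist (5) = V) →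
      V.HasGoodReductionAtPrime 5 → V.frobeniusTrace 5 = 0 →
      QuadraticBranchPlusEtaMainConjectureAt V 5 := by
  intro V' _ _ V _ _ _ hC' hgood' hap' hC hgood hap
  subst hW; subst hA
  haveI := EtaCMUnitRecords.isElliptic_900b1
  haveI := EtaCMUnitRecords.isGloballyMinimal_900b1
  haveI := isElliptic_26100c1
  have hcong : ModPCongruent V' V 5 :=
    EtaModFiveCongruenceRecords.modPCongruent_twist5_900b1_26100c1 hF _ _ rfl rfl V' V hC' hC
  obtain ⟨C', hC'V'⟩ := hC'
  have hD : ((-1 : ℚ) ^ ((5 : ℕ) / 2) * ((5 : ℕ) : ℚ)) = 5 := by norm_num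
  exact EtaCMAnchorTransfer.quadraticBranchPlusEtaMainConjectureAt_of_cmUnitAnchor_of_transferFrame 5 hCL hmod hGZK hS28
    (le_refl 5) _ hasCM_900b1 hLA ⟨1, by exact_mod_cast hm, by simp⟩ htam V' C' (by rw [hD]; exact hC'V') hgood' hap' V hgood
    hap hcong

set_option maxRecDepth 100000 in
/-- **(C1⁺_η) at `p = 5` for every good `a_5 = 0` globally minimal model `V` of the `5`-twist of `78300bh1`**
(`[0, 0, 0, -705375, 135465750]`; non-CM, `Im ρ̄ = C_ns⁺(5)`, rank `0`; Cremona: `Tam = 10`, `#Ш_an = 1`) BY THE CM-UNIT-ANCHOR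
TRANSFER ROAD: the row is `5`-congruent to the unit sibling `A = [0,0,0,0,−675]` of the class of `2700p1` (CM, `r_an = 0`,
`#Ш_an = 1`, `Tam = 3`; displayed `hLA hm htam`) — on the twist side the congruence `V′[5] ≃ V[5]` for ALL models is the kernel
record `EtaModFiveCongruenceRecords.modPCongruent_twist5_A2700_78300bh1` (the twisted row is the point `(λ:μ) = (-900 : 1)` of
the INDIRECT Hesse family of the twisted anchor), conditional on Fisher's `thm58_geomTorsionFive_of_dualHesseFamily` only; at
the anchor's twist (C1⁺_η) and `μ = 0` are TREE THEOREMS (`EtaUnitRows`, `EtaMuBound`; mod `hmod hGZK hS28`); the transfer is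
the OPEN binder `hCL` (Corpuz–Lei 2025 Thms 1–3 at `i = (p−1)/2`, PREPRINT). NO hypothesis on the row beyond its model: no rank,
no `L`-value, no shape of `L_5⁺`, no analytic `μ`, no Kobayashi Thm. 2.2/4.1, no Hatley–Lei, no Poitou–Tate, no Kitajima–Otsuki,
no (A), no `L₀`. Per-row instance of
`EtaCMAnchorTransfer.quadraticBranchPlusEtaMainConjectureAt_of_cmUnitAnchor_of_transferFrame`; CONDITIONAL on `hCL` (PRE) and
the named facts; nothing booked; BSD(W,5) claimed for no pair. [claim: CorpuzLei2025, status: under-review]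
[cite: Fisher2013TwistsOfX5, Thm. 5.8] [cite: Kobayashi2003, §4 Even main conjecture (p. 8)]
[cite: GreenbergVatsal2000, Thm. (1.4)] [cite: BurungaleFlach2024, Thm. 1.1 and Cor. 2]
[cite: Cremona1997, Table 1 (label 78300bh1)] -/
theorem etaMC_78300bh1_5_cmAnchorTransfer (hCL : CorpuzLei2025_etaPlusMainConjecture_transfer_OPEN)
    (hmod : hasEntireLFunction_rat) (hGZK : rank_eq_analyticRank_of_analyticRank_le_one)
    (hS28 : bsdTriple_of_hasCM_of_L_one_ne_zero) (hF : thm58_geomTorsionFive_of_dualHesseFamily)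
    (W : WeierstrassCurve ℚ) (hW : W = ⟨0, 0, 0, (-705375), 135465750⟩) (A : WeierstrassCurve ℚ) (hA : A = ⟨0, 0, 0, 0, (-675)⟩)
    (hLA : A.entireLFunction 1 ≠ 0) (hm : shaAn A = ((1 : ℕ) : ℂ)) (htam : ¬ 5 ∣ A.tamagawaProduct) :
    ∀ (V' : WeierstrassCurve ℚ) [V'.IsElliptic] [V'.IsGloballyMinimal]
      (V : WeierstrassCurve ℚ) [V.IsElliptic] [V.IsGloballyMinimal] [Fact (5 : ℕ).Prime],
      (∃ C' : VariableChange ℚ, C' • A.quadraticTwist (5) = V') →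
      V'.HasGoodReductionAtPrime 5 → V'.frobeniusTrace 5 = 0 →
      (∃ C : VariableChange ℚ, C • W.quadraticTwist (5) = V) →
      V.HasGoodReductionAtPrime 5 → V.frobeniusTrace 5 = 0 →
      QuadraticBranchPlusEtaMainConjectureAt V 5 := by
  intro V' _ _ V _ _ _ hC' hgood' hap' hC hgood hap
  subst hW; subst hA
  haveI := EtaFineRoadRecords.isElliptic_A2700
  haveI := EtaFineRoadRecords.isGloballyMinimal_A2700
  haveI := EtaFineRoadRecords.isElliptic_78300bh1
  have hcong : ModPCongruent V' V 5 :=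
    EtaModFiveCongruenceRecords.modPCongruent_twist5_A2700_78300bh1 hF _ _ rfl rfl V' V hC' hC
  obtain ⟨C', hC'V'⟩ := hC'
  have hD : ((-1 : ℚ) ^ ((5 : ℕ) / 2) * ((5 : ℕ) : ℚ)) = 5 := by norm_num
  exact EtaCMAnchorTransfer.quadraticBranchPlusEtaMainConjectureAt_of_cmUnitAnchor_of_transferFrame 5 hCL hmod hGZK hS28
    (le_refl 5) _ EtaFineRoadRecords.hasCM_A2700 hLA ⟨1, by exact_mod_cast hm, by simp⟩ htam V' C' (by rw [hD]; exact hC'V') hgood' hap' V hgood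
    hap hcong

set_option maxRecDepth 100000 in
/-- **(C1⁺_η) at `p = 5` for every good `a_5 = 0` globally minimal model `V` of the `5`-twist of `104400cr1`**
(`[0, 0, 0, -77625, 17404875]`; non-CM, `Im ρ̄ = C_ns⁺(5)`, rank `0`; Cremona: `Tam = 4`, `#Ш_an = 1`) BY THE CM-UNIT-ANCHOR
TRANSFER ROAD: the row is `5`-congruent to `3600bb1` = `[0,0,0,0,−125]` (CM, `r_an = 0`, `#Ш_an = 1`, `Tam = 4`; displayed
`hLA hm htam`) — on the twist side the congruence `V′[5] ≃ V[5]` for ALL models is the kernel record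
`EtaModFiveCongruenceRecords.modPCongruent_twist5_3600bb1_104400cr1` (the twisted row is the point `(λ:μ) = (300 : 1)` of the
DIRECT Hesse family of the twisted anchor), conditional on Fisher's `thm132_geomTorsionFive_of_hesseFamily` only; at the
anchor's twist (C1⁺_η) and `μ = 0` are TREE THEOREMS (`EtaUnitRows`, `EtaMuBound`; mod `hmod hGZK hS28`); the transfer is the
OPEN binder `hCL` (Corpuz–Lei 2025 Thms 1–3 at `i = (p−1)/2`, PREPRINT). NO hypothesis on the row beyond its model: no rank, no
`L`-value, no shape of `L_5⁺`, no analytic `μ`, no Kobayashi Thm. 2.2/4.1, no Hatley–Lei, no Poitou–Tate, no Kitajima–Otsuki, no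
(A), no `L₀`. Per-row instance of `EtaCMAnchorTransfer.quadraticBranchPlusEtaMainConjectureAt_of_cmUnitAnchor_of_transferFrame`;
CONDITIONAL on `hCL` (PRE) and the named facts; nothing booked; BSD(W,5) claimed for no pair.
[claim: CorpuzLei2025, status: under-review] [cite: Fisher2012Hessian, Thm. 13.2 (i)]
[cite: Kobayashi2003, §4 Even main conjecture (p. 8)] [cite: GreenbergVatsal2000, Thm. (1.4)]
[cite: BurungaleFlach2024, Thm. 1.1 and Cor. 2] [cite: Cremona1997, Table 1 (label 104400cr1)] -/
theorem etaMC_104400cr1_5_cmAnchorTransfer (hCL : CorpuzLei2025_etaPlusMainConjecture_transfer_OPEN)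
    (hmod : hasEntireLFunction_rat) (hGZK : rank_eq_analyticRank_of_analyticRank_le_one)
    (hS28 : bsdTriple_of_hasCM_of_L_one_ne_zero) (hF : thm132_geomTorsionFive_of_hesseFamily)
    (W : WeierstrassCurve ℚ) (hW : W = ⟨0, 0, 0, (-77625), 17404875⟩) (A : WeierstrassCurve ℚ) (hA : A = ⟨0, 0, 0, 0, (-125)⟩)
    (hLA : A.entireLFunction 1 ≠ 0) (hm : shaAn A = ((1 : ℕ) : ℂ)) (htam : ¬ 5 ∣ A.tamagawaProduct) :
    ∀ (V' : WeierstrassCurve ℚ) [V'.IsElliptic] [V'.IsGloballyMinimal]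
      (V : WeierstrassCurve ℚ) [V.IsElliptic] [V.IsGloballyMinimal] [Fact (5 : ℕ).Prime],
      (∃ C' : VariableChange ℚ, C' • A.quadraticTwist (5) = V') →
      V'.HasGoodReductionAtPrime 5 → V'.frobeniusTrace 5 = 0 →
      (∃ C : VariableChange ℚ, C • W.quadraticTwist (5) = V) →
      V.HasGoodReductionAtPrime 5 → V.frobeniusTrace 5 = 0 →
      QuadraticBranchPlusEtaMainConjectureAt V 5 := by
  intro V' _ _ V _ _ _ hC' hgood' hap' hC hgood hap
  subst hW; subst hA
  haveI := EtaCMUnitRecords.isElliptic_3600bb1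
  haveI := EtaCMUnitRecords.isGloballyMinimal_3600bb1
  haveI := isElliptic_104400cr1
  have hcong : ModPCongruent V' V 5 :=
    EtaModFiveCongruenceRecords.modPCongruent_twist5_3600bb1_104400cr1 hF _ _ rfl rfl V' V hC' hC
  obtain ⟨C', hC'V'⟩ := hC'
  have hD : ((-1 : ℚ) ^ ((5 : ℕ) / 2) * ((5 : ℕ) : ℚ)) = 5 := by norm_num
  exact EtaCMAnchorTransfer.quadraticBranchPlusEtaMainConjectureAt_of_cmUnitAnchor_of_transferFrame 5 hCL hmod hGZK hS28
    (le_refl 5) _ hasCM_3600bb1 hLA ⟨1, by exact_mod_cast hm, by simp⟩ htam V' C' (by rw [hD]; exact hC'V') hgood' hap' V hgood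
    hap hcong

set_option maxRecDepth 100000 in
/-- **(C1⁺_η) at `p = 5` for every good `a_5 = 0` globally minimal model `V` of the `5`-twist of `159300l1`**
(`[0, 0, 0, -121125, 12756625]`; non-CM, `Im ρ̄ = C_ns⁺(5)`, rank `0`; Cremona: `Tam = 10`, `#Ш_an = 1`) BY THE CM-UNIT-ANCHOR
TRANSFER ROAD: the row is `5`-congruent to the unit sibling `A = [0,0,0,0,−675]` of the class of `2700p1` (CM, `r_an = 0`,
`#Ш_an = 1`, `Tam = 3`; displayed `hLA hm htam`) — on the twist side the congruence `V′[5] ≃ V[5]` for ALL models is the kernel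
record `EtaModFiveCongruenceRecords.modPCongruent_twist5_A2700_159300l1` (the twisted row is the point `(λ:μ) = (-900 : 1)` of
the DIRECT Hesse family of the twisted anchor), conditional on Fisher's `thm132_geomTorsionFive_of_hesseFamily` only; at the
anchor's twist (C1⁺_η) and `μ = 0` are TREE THEOREMS (`EtaUnitRows`, `EtaMuBound`; mod `hmod hGZK hS28`); the transfer is the
OPEN binder `hCL` (Corpuz–Lei 2025 Thms 1–3 at `i = (p−1)/2`, PREPRINT). NO hypothesis on the row beyond its model: no rank, no
`L`-value, no shape of `L_5⁺`, no analytic `μ`, no Kobayashi Thm. 2.2/4.1, no Hatley–Lei, no Poitou–Tate, no Kitajima–Otsuki, no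
(A), no `L₀`. Per-row instance of `EtaCMAnchorTransfer.quadraticBranchPlusEtaMainConjectureAt_of_cmUnitAnchor_of_transferFrame`;
CONDITIONAL on `hCL` (PRE) and the named facts; nothing booked; BSD(W,5) claimed for no pair.
[claim: CorpuzLei2025, status: under-review] [cite: Fisher2012Hessian, Thm. 13.2 (i)]
[cite: Kobayashi2003, §4 Even main conjecture (p. 8)] [cite: GreenbergVatsal2000, Thm. (1.4)]
[cite: BurungaleFlach2024, Thm. 1.1 and Cor. 2] [cite: Cremona1997, Table 1 (label 159300l1)] -/
theorem etaMC_159300l1_5_cmAnchorTransfer (hCL : CorpuzLei2025_etaPlusMainConjecture_transfer_OPEN)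
    (hmod : hasEntireLFunction_rat) (hGZK : rank_eq_analyticRank_of_analyticRank_le_one)
    (hS28 : bsdTriple_of_hasCM_of_L_one_ne_zero) (hF : thm132_geomTorsionFive_of_hesseFamily)
    (W : WeierstrassCurve ℚ) (hW : W = ⟨0, 0, 0, (-121125), 12756625⟩) (A : WeierstrassCurve ℚ) (hA : A = ⟨0, 0, 0, 0, (-675)⟩)
    (hLA : A.entireLFunction 1 ≠ 0) (hm : shaAn A = ((1 : ℕ) : ℂ)) (htam : ¬ 5 ∣ A.tamagawaProduct) :
    ∀ (V' : WeierstrassCurve ℚ) [V'.IsElliptic] [V'.IsGloballyMinimal]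
      (V : WeierstrassCurve ℚ) [V.IsElliptic] [V.IsGloballyMinimal] [Fact (5 : ℕ).Prime],
      (∃ C' : VariableChange ℚ, C' • A.quadraticTwist (5) = V') →
      V'.HasGoodReductionAtPrime 5 → V'.frobeniusTrace 5 = 0 →
      (∃ C : VariableChange ℚ, C • W.quadraticTwist (5) = V) →
      V.HasGoodReductionAtPrime 5 → V.frobeniusTrace 5 = 0 →
      QuadraticBranchPlusEtaMainConjectureAt V 5 := by
  intro V' _ _ V _ _ _ hC' hgood' hap' hC hgood hap
  subst hW; subst hA
  haveI := EtaFineRoadRecords.isElliptic_A2700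
  haveI := EtaFineRoadRecords.isGloballyMinimal_A2700
  haveI := EtaFineRoadRecords.isElliptic_159300l1
  have hcong : ModPCongruent V' V 5 :=
    EtaModFiveCongruenceRecords.modPCongruent_twist5_A2700_159300l1 hF _ _ rfl rfl V' V hC' hC
  obtain ⟨C', hC'V'⟩ := hC'
  have hD : ((-1 : ℚ) ^ ((5 : ℕ) / 2) * ((5 : ℕ) : ℚ)) = 5 := by norm_num
  exact EtaCMAnchorTransfer.quadraticBranchPlusEtaMainConjectureAt_of_cmUnitAnchor_of_transferFrame 5 hCL hmod hGZK hS28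
    (le_refl 5) _ EtaFineRoadRecords.hasCM_A2700 hLA ⟨1, by exact_mod_cast hm, by simp⟩ htam V' C' (by rw [hD]; exact hC'V') hgood' hap' V hgood
    hap hcong

set_option maxRecDepth 100000 in
/-- **(C1⁺_η) at `p = 5` for every good `a_5 = 0` globally minimal model `V` of the `5`-twist of `162675n1`**
(`[0, 0, 1, -10374750, -13063103719]`; non-CM, `Im ρ̄ = C_ns⁺(5)`, rank `0`; Cremona: `Tam = 10`, `#Ш_an = 4`) BY THE
CM-UNIT-ANCHOR TRANSFER ROAD: the row is `5`-congruent to the unit sibling `A = [0,0,1,0,−169]` of the class of `675a1` (CM,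
`r_an = 0`, `#Ш_an = 1`, `Tam = 1`; displayed `hLA hm htam`) — on the twist side the congruence `V′[5] ≃ V[5]` for ALL models is
the kernel record `EtaModFiveCongruenceRecords.modPCongruent_twist5_A675_162675n1` (the twisted row is the point
`(λ:μ) = (-225 : 1)` of the INDIRECT Hesse family of the twisted anchor), conditional on Fisher's
`thm58_geomTorsionFive_of_dualHesseFamily` only; at the anchor's twist (C1⁺_η) and `μ = 0` are TREE THEOREMS (`EtaUnitRows`,
`EtaMuBound`; mod `hmod hGZK hS28`); the transfer is the OPEN binder `hCL` (Corpuz–Lei 2025 Thms 1–3 at `i = (p−1)/2`,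
PREPRINT). NO hypothesis on the row beyond its model: no rank, no `L`-value, no shape of `L_5⁺`, no analytic `μ`, no Kobayashi
Thm. 2.2/4.1, no Hatley–Lei, no Poitou–Tate, no Kitajima–Otsuki, no (A), no `L₀`. Per-row instance of
`EtaCMAnchorTransfer.quadraticBranchPlusEtaMainConjectureAt_of_cmUnitAnchor_of_transferFrame`; CONDITIONAL on `hCL` (PRE) and
the named facts; nothing booked; BSD(W,5) claimed for no pair. [claim: CorpuzLei2025, status: under-review]
[cite: Fisher2013TwistsOfX5, Thm. 5.8] [cite: Kobayashi2003, §4 Even main conjecture (p. 8)]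
[cite: GreenbergVatsal2000, Thm. (1.4)] [cite: BurungaleFlach2024, Thm. 1.1 and Cor. 2]
[cite: Cremona1997, Table 1 (label 162675n1)] -/
theorem etaMC_162675n1_5_cmAnchorTransfer (hCL : CorpuzLei2025_etaPlusMainConjecture_transfer_OPEN)
    (hmod : hasEntireLFunction_rat) (hGZK : rank_eq_analyticRank_of_analyticRank_le_one)
    (hS28 : bsdTriple_of_hasCM_of_L_one_ne_zero) (hF : thm58_geomTorsionFive_of_dualHesseFamily)
    (W : WeierstrassCurve ℚ) (hW : W = ⟨0, 0, 1, (-10374750), (-13063103719)⟩) (A : WeierstrassCurve ℚ) (hA : A = ⟨0, 0, 1, 0, (-169)⟩)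
    (hLA : A.entireLFunction 1 ≠ 0) (hm : shaAn A = ((1 : ℕ) : ℂ)) (htam : ¬ 5 ∣ A.tamagawaProduct) :
    ∀ (V' : WeierstrassCurve ℚ) [V'.IsElliptic] [V'.IsGloballyMinimal]
      (V : WeierstrassCurve ℚ) [V.IsElliptic] [V.IsGloballyMinimal] [Fact (5 : ℕ).Prime],
      (∃ C' : VariableChange ℚ, C' • A.quadraticTwist (5) = V') →
      V'.HasGoodReductionAtPrime 5 → V'.frobeniusTrace 5 = 0 →
      (∃ C : VariableChange ℚ, C • W.quadraticTwist (5) = V) →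
      V.HasGoodReductionAtPrime 5 → V.frobeniusTrace 5 = 0 →
      QuadraticBranchPlusEtaMainConjectureAt V 5 := by
  intro V' _ _ V _ _ _ hC' hgood' hap' hC hgood hap
  subst hW; subst hA
  haveI := EtaFineRoadRecords.isElliptic_A675
  haveI := EtaFineRoadRecords.isGloballyMinimal_A675
  haveI := EtaFineRoadRecords.isElliptic_162675n1
  have hcong : ModPCongruent V' V 5 :=
    EtaModFiveCongruenceRecords.modPCongruent_twist5_A675_162675n1 hF _ _ rfl rfl V' V hC' hC
  obtain ⟨C', hC'V'⟩ := hC'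
  have hD : ((-1 : ℚ) ^ ((5 : ℕ) / 2) * ((5 : ℕ) : ℚ)) = 5 := by norm_num
  exact EtaCMAnchorTransfer.quadraticBranchPlusEtaMainConjectureAt_of_cmUnitAnchor_of_transferFrame 5 hCL hmod hGZK hS28
    (le_refl 5) _ EtaFineRoadRecords.hasCM_A675 hLA ⟨1, by exact_mod_cast hm, by simp⟩ htam V' C' (by rw [hD]; exact hC'V') hgood' hap' V hgood
    hap hcong

end EtaCMAnchorTransferRecords

end Summit.BirchSwinnertonDyer.BirchSwinnertonDyer.Theorems

end
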